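import Mathlib

/-!
# Self-converse lift of a gadget of direct pairs (siege k5: Mathlib API route)

Item `stmt-MatrixMultiplication-14308` (`FourierTwoFamiliesModP.PrimeTwoFamilies`, CKSU 2005 Conj. 4.7 with
prime cyclic hosts), line `Sketch` (capacity-gadget form), registered stub `selfConverseLift`.

Setting.  `K` is an abelian group, `(P σ, Q σ)_{σ<r}` a GADGET: a list of pairs of finite subsets of `K`,
each DIRECT (`hD`: inside one pair the relation `(x - x') + (y - y') = 0` forces `x = x'`, `y = y'`).
Letter `σ` is STRONGLY SEPARATED towards `τ` when every cross difference `q - p` (`p ∈ P σ`, `q ∈ Q τ`)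
differs from every diagonal difference `q' - p'` (`p' ∈ P c`, `q' ∈ Q c`, any letter `c`).  A map `π` on
the letters is a SELF-CONVERSE CERTIFICATE (`hπ`) when every ordered pair of distinct letters is strongly
separated either directly or after `π`.

Claim (`selfConverseLift`).  The `r` product blocks `(P σ ×ˢ P (π σ), Q σ ×ˢ Q (π σ))` of `K × K`
satisfy the two clauses of the simultaneous double product property verbatim as in the route statement:
(W) each block is direct, and (X) a relation `(a - a') + (b - b') = 0` with `a ∈ A i`, `a' ∈ A j`,
`b ∈ B j`, `b' ∈ B k` forces `i = k`.

Proof route of this file (the assigned variation: Mathlib API).  All algebra is delegated to named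
Mathlib lemmas, with no normalisation tactics:
* `rel_iff_sub_eq_sub` — the SDPP relation `(a - a') + (b - b') = 0` IS the coincidence of differences
  `b' - a = b - a'`, by the rewrite chain `sub_add_sub_comm`, `sub_eq_zero`, `sub_eq_sub_iff_add_eq_add`,
  `add_comm`;
* `rel_map` — the relation is transported along any additive monoid homomorphism (`map_sub`, `map_add`,
  `map_zero`); instantiated at the two projections `AddMonoidHom.fst K K`, `AddMonoidHom.snd K K` it reads a
  relation in `K × K` coordinatewise;
* `not_rel_of_strongSep` — at a strongly separated pair of letters the coincidence of differences is
  forbidden, so no relation exists;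
* the blocks are read through `Finset.mem_product` and points of `K × K` are compared by `Prod.ext`.
Clause (W) is then `hD` in each coordinate, and clause (X) is `not_rel_of_strongSep` at the coordinate
selected by the certificate `hπ i k`.

(The original proof of the stub is `…Theorems.PrimeTwoFamilies.CapacityLift.selfConverseLift`, p96487;
this file is an independent proof in its own namespace, as the siege protocol requires.)
-/

-- single-conjunct summit: the mandated namespace repeats `MatrixMultiplication` (summit = sub-problem).
set_option linter.dupNamespace false

namespace Summit.MatrixMultiplication.MatrixMultiplication.Theorems.PrimeTwoFamilies.SelfConverseLiftK5

open Finset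

/-- **The relation is a coincidence of differences.**  In an abelian group,
`(a - a') + (b - b') = 0 ↔ b' - a = b - a'` (rewrite chain `sub_add_sub_comm`, `sub_eq_zero`,
`sub_eq_sub_iff_add_eq_add`, `add_comm`, `eq_comm`). -/
theorem rel_iff_sub_eq_sub {K : Type*} [AddCommGroup K] (a a' b b' : K) :
    (a - a') + (b - b') = 0 ↔ b' - a = b - a' := by
  rw [sub_add_sub_comm, sub_eq_zero, sub_eq_sub_iff_add_eq_add, add_comm b' a', add_comm b a, eq_comm]

/-- **Transport of the relation along an additive homomorphism** (`map_sub`, `map_add`, `map_zero`):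
if `(a - a') + (b - b') = 0` then `(f a - f a') + (f b - f b') = 0` for every additive monoid
homomorphism `f` (any `AddMonoidHomClass` map). -/
theorem rel_map {K K' F : Type*} [AddCommGroup K] [AddCommGroup K'] [FunLike F K K']
    [AddMonoidHomClass F K K'] (f : F) {a a' b b' : K} (h : (a - a') + (b - b') = 0) :
    (f a - f a') + (f b - f b') = 0 := by
  rw [← map_sub, ← map_sub, ← map_add, h, map_zero]

/-- **No relation across a strongly separated pair.**  If letter `i` is strongly separated towards
letter `k` (`hs`), then no relation `(a - a') + (b - b') = 0` has `a ∈ P i`, `a' ∈ P j`, `b ∈ Q j`,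
`b' ∈ Q k`: by `rel_iff_sub_eq_sub` it would be the forbidden coincidence `b' - a = b - a'` of the cross
difference `b' - a ∈ Q k - P i` with the diagonal difference `b - a' ∈ Q j - P j`. -/
theorem not_rel_of_strongSep {K : Type*} [AddCommGroup K] {r : ℕ} {P Q : Fin r → Finset K}
    {i j k : Fin r}
    (hs : ∀ p ∈ P i, ∀ q ∈ Q k, ∀ c : Fin r, ∀ p' ∈ P c, ∀ q' ∈ Q c, q - p ≠ q' - p')
    {a a' b b' : K} (ha : a ∈ P i) (ha' : a' ∈ P j) (hb : b ∈ Q j) (hb' : b' ∈ Q k) :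
    (a - a') + (b - b') ≠ 0 :=
  fun h => hs a ha b' hb' j a' ha' b hb ((rel_iff_sub_eq_sub a a' b b').1 h)

/-- **SELF-CONVERSE LIFT** (registered stub `selfConverseLift` of crux `stmt-MatrixMultiplication-14308`,
verbatim).  If every letter `(P c, Q c)` is direct (`hD`) and a map `π` on the letters strongly separates
every ordered pair of distinct letters either directly or after `π` (`hπ`), then the `r` blocks
`(P σ ×ˢ P (π σ), Q σ ×ˢ Q (π σ))` in `K × K` satisfy clause (W) (first conjunct: `hD` in each
coordinate, read off by `rel_map` at `AddMonoidHom.fst K K` / `AddMonoidHom.snd K K`, reassembled by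
`Prod.ext`) and clause (X) (second conjunct: for `i ≠ k` the certificate `hπ i k` names the coordinate
in which `not_rel_of_strongSep` refutes the relation). -/
theorem selfConverseLift {K : Type*} [AddCommGroup K] [DecidableEq K] {r : ℕ}
    (P Q : Fin r → Finset K)
    (hD : ∀ c : Fin r, ∀ x ∈ P c, ∀ x' ∈ P c, ∀ y ∈ Q c, ∀ y' ∈ Q c,
      (x - x') + (y - y') = 0 → x = x' ∧ y = y')
    (π : Fin r → Fin r)
    (hπ : ∀ σ τ : Fin r, σ ≠ τ →
      (∀ p ∈ P σ, ∀ q ∈ Q τ, ∀ c : Fin r, ∀ p' ∈ P c, ∀ q' ∈ Q c, q - p ≠ q' - p') ∨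
      (∀ p ∈ P (π σ), ∀ q ∈ Q (π τ), ∀ c : Fin r, ∀ p' ∈ P c, ∀ q' ∈ Q c, q - p ≠ q' - p')) :
    (∀ σ : Fin r, ∀ a ∈ P σ ×ˢ P (π σ), ∀ a' ∈ P σ ×ˢ P (π σ),
      ∀ b ∈ Q σ ×ˢ Q (π σ), ∀ b' ∈ Q σ ×ˢ Q (π σ),
        (a - a') + (b - b') = 0 → a = a' ∧ b = b') ∧
    (∀ i j k : Fin r, ∀ a ∈ P i ×ˢ P (π i), ∀ a' ∈ P j ×ˢ P (π j),
      ∀ b ∈ Q j ×ˢ Q (π j), ∀ b' ∈ Q k ×ˢ Q (π k),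
        (a - a') + (b - b') = 0 → i = k) := by
  refine ⟨fun σ a ha a' ha' b hb b' hb' h => ?_, fun i j k a ha a' ha' b hb b' hb' h => ?_⟩
  · -- (W): directness of letter `σ` in the first coordinate and of letter `π σ` in the second
    rw [Finset.mem_product] at ha ha' hb hb'
    obtain ⟨e₁, f₁⟩ :=
      hD σ a.1 ha.1 a'.1 ha'.1 b.1 hb.1 b'.1 hb'.1 (rel_map (AddMonoidHom.fst K K) h)
    obtain ⟨e₂, f₂⟩ :=
      hD (π σ) a.2 ha.2 a'.2 ha'.2 b.2 hb.2 b'.2 hb'.2 (rel_map (AddMonoidHom.snd K K) h)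
    exact ⟨Prod.ext e₁ e₂, Prod.ext f₁ f₂⟩
  · -- (X): the certificate `hπ i k` selects the coordinate where the relation cannot hold
    rw [Finset.mem_product] at ha ha' hb hb'
    by_contra hik
    rcases hπ i k hik with hs | hs
    · exact not_rel_of_strongSep hs ha.1 ha'.1 hb.1 hb'.1 (rel_map (AddMonoidHom.fst K K) h)
    · exact not_rel_of_strongSep hs ha.2 ha'.2 hb.2 hb'.2 (rel_map (AddMonoidHom.snd K K) h)

end Summit.MatrixMultiplication.MatrixMultiplication.Theorems.PrimeTwoFamilies.SelfConverseLiftK5
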